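import Mathlib
import HarnessLib
import Literature.MathematicalPhysics.KineticTheory.VelocityFlipNoise
import Literature.MathematicalPhysics.KineticTheory.VelocityFlipEmbeddedChainSteadyState
import Literature.MathematicalPhysics.KineticTheory.LangevinChainLyapunov
import Literature.Probability.Process.HarrisTheorem
import Summits.AtomisticToContinuum.FouriersLaw.Theorems.BondHeatUncertaintySubdiffusiveBondHeatKernelGibbsE
import Summits.AtomisticToContinuum.FouriersLaw.Theorems.JunctionLocalitySuperadditiveResistanceStubBypassBoundAux2
import Summits.AtomisticToContinuum.FouriersLaw.Theorems.VanishingNoiseTransferVanishingNoiseBoundFlipContinuity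
import Summits.AtomisticToContinuum.FouriersLaw.Theorems.VanishingNoiseTransferVanishingNoiseBoundFlipMildForwardField
import Summits.AtomisticToContinuum.FouriersLaw.Theorems.VanishingNoiseTransferVanishingNoiseBoundFlipFamilyMoments

/-!
# The centred mild forward field of the flip-noisy generator at UNEQUAL bath temperatures

`--supports stmt-AtomisticToContinuum-11976` helper file (crux `VanishingNoiseBound`, route
`VanishingNoiseTransfer`, line `fekete-usc-one-length`, stub S3' `stub_flipForwardFieldRegularity`, wave 4).
Clause (ii) of the derivative-free hypothesis `FF''(ε)` of the dual Kubo road (`…FlipDualKuboLink`): for the pinned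
chain `pinnedChain ω₂ lam β γ` (all parameters `> 0`), `N ≥ 2`, a reference temperature `T > 0`, bath temperatures
`T_L, T_R > 0` with `1/(4T) < 1/max(T_L, T_R)` (e.g. `T_L, T_R = T ± δ/2`, `|δ| < 6T`), a flip rate `ε > 0`, and the
unique weak flip steady state `μ` at `(T_L, T_R)`:

* `flip_mildForwardField_exists_temps` — there is a measurable `g` with `|g| ≤ C e^{H/(4T)}` solving the CENTRED
  mild Poisson equation `g = R((Nε)⁻¹ (k_0 − μ(k_0)) + Q g)`, `k_0 = p_0² − T`, `R = R_{Nε}` the resolvent kernel of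
  the flip-free dynamics at `(T_L, T_R)`, `Q` the flip average — the resolvent form of
  `(L_{T_L,T_R} + εS) g = −(k_0 − μ(k_0))`. Proof = the equal-temperature twin `flip_mildForwardField_exists`
  (`…FlipMildForwardField`, Harris for the embedded flip chain `K = Q ∘ₖ R`) verbatim, centred because the
  `K`-invariant law `π` has `π R = μ` (uniqueness of the flip steady state) and `μ` integrates `k_0`
  (`integrable_exp_of_unique`, `…FlipFamilyMoments`), so `π(R(k_0 − μ(k_0))) = μ(k_0) − μ(k_0) = 0`.
* `helper_flipMildForwardFieldTemps` — registered helper (notation-free restatement).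

References: Bernardin–Olla 2011 §2.1, Prop. 1; Hairer–Mattingly 2011; Cuneo–Eckmann–Hairer–Rey-Bellet 2018 §3;
Ethier–Kurtz 1986 Ch. 1 §2 (resolvents).
-/

noncomputable section

open MeasureTheory ProbabilityTheory Filter Topology Set
open scoped NNReal ENNReal Topology ContDiff BoundedContinuousFunction
open Literature.MathematicalPhysics.KineticTheory.HeatConduction Literature.Probability.Process OscillatorChain
open Summit.AtomisticToContinuum.FouriersLaw.Theorems.SubdiffusiveBondHeat (abs_sq_momentum_sub_le_exp integrable_of_abs_le_exp)
open Summit.AtomisticToContinuum.FouriersLaw.Cruxes.SuperadditiveResistance.FloatingProbeBypassLaplacian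
  (pinnedChain_memLp_two_snd pinnedChain_integral_snd_sq)

namespace Summit.AtomisticToContinuum.FouriersLaw.Theorems.VanishingNoiseBound

section Mild

variable {ω₂ lam β γ : ℝ} {N : ℕ}

set_option maxHeartbeats 800000 in
/-- **The centred mild forward field of `L_{T_L,T_R} + εS` exists.** See the module docstring. -/
theorem flip_mildForwardField_exists_temps (hω : 0 < ω₂) (hl : 0 < lam) (hβ : 0 < β) (hγ : 0 < γ)
    (hN : 1 < N) {T T_L T_R : ℝ} (hT : 0 < T) (hTL : 0 < T_L) (hTR : 0 < T_R)
    (hθ' : 1 / (4 * T) < 1 / max T_L T_R) {ε : ℝ} (hε : 0 < ε) {μ : Measure (PhaseSpace N)}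
    (hμ : (pinnedChain ω₂ lam β γ).IsFlipSteadyState N T_L T_R ε μ ∧
      ∀ ν : Measure (PhaseSpace N), (pinnedChain ω₂ lam β γ).IsFlipSteadyState N T_L T_R ε ν → ν = μ) :
    ∃ g : PhaseSpace N → ℝ, Measurable g ∧
      (∃ C : ℝ, ∀ z, |g z| ≤ C * Real.exp (1 / (4 * T) * (pinnedChain ω₂ lam β γ).hamiltonian N z)) ∧
      ∀ z, g z = ∫ y, (((N : ℝ) * ε)⁻¹ * ((y.2 ⟨0, Nat.zero_lt_of_lt hN⟩ ^ 2 - T) -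
            ∫ w, (w.2 ⟨0, Nat.zero_lt_of_lt hN⟩ ^ 2 - T) ∂μ) +
          (N : ℝ)⁻¹ * ∑ i : Fin N, g (momentumFlip i y))
        ∂((pinnedChainSemigroup hω hl.le hβ.le hγ.le (Nat.zero_lt_of_lt hN) hTL.le hTR.le).resolventKernel
          ((N : ℝ) * ε) z) := by
  have hN0 : 0 < N := Nat.zero_lt_of_lt hN
  set P := pinnedChain ω₂ lam β γ with hP
  set Sg := pinnedChainSemigroup hω hl.le hβ.le hγ.le hN0 hTL.le hTR.le with hSg
  set r : ℝ := (N : ℝ) * ε with hr_def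
  have hr : 0 < r := by positivity
  set R := Sg.resolventKernel r with hRdef
  haveI hRM : IsMarkovKernel R := Sg.isMarkovKernel_resolventKernel hr
  set K := Sg.embeddedFlipKernel r with hKdef
  haveI hKM : IsMarkovKernel K := Sg.isMarkovKernel_embeddedFlipKernel hr
  have hKeq : K = flipKernel N ∘ₖ R := Sg.embeddedFlipKernel_eq r
  set H : PhaseSpace N → ℝ := P.hamiltonian N with hH
  have hHc : Continuous H := pinnedChain_continuous_hamiltonian ω₂ lam β γ N
  have hH0 : ∀ x, 0 ≤ H x := fun x => pinnedChain_hamiltonian_nonneg hω.le hl.le hβ.le γ N x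
  set θ : ℝ := 1 / (4 * T) with hθ
  have hθ0 : 0 < θ := by positivity
  have hθ'' : θ < 1 / max T_L T_R := hθ'
  -- the Lyapunov weight
  let V : PhaseSpace N → ℝ≥0 := fun x => (Real.exp (θ * H x)).toNNReal
  have hVc : Continuous V := continuous_real_toNNReal.comp (Real.continuous_exp.comp (continuous_const.mul hHc))
  have hVm : Measurable V := hVc.measurable
  have hVcoe : ∀ x, ((V x : ℝ≥0) : ℝ≥0∞) = ENNReal.ofReal (Real.exp (θ * H x)) := fun x => rfl
  have hVreal : ∀ x, ((V x : ℝ≥0) : ℝ) = Real.exp (θ * H x) := fun x => Real.coe_toNNReal _ (Real.exp_pos _).le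
  have hVge1 : ∀ x, (1 : ℝ) ≤ V x := fun x => by
    rw [hVreal]; exact Real.one_le_exp (mul_nonneg hθ0.le (hH0 x))
  have hVflip : ∀ (i : Fin N) (x : PhaseSpace N), ((V (momentumFlip i x) : ℝ≥0) : ℝ≥0∞) = V x := by
    intro i x; simp only [V, hH, OscillatorChain.hamiltonian_momentumFlip]
  -- (1) drift for `K` with `ℝ≥0` constants
  obtain ⟨a, b, ha, hb, hlyR⟩ :=
    pinnedChain_lintegral_exp_hamiltonian_resolventKernel_le hω hl hβ hγ hN hTL hTR hr hθ0 hθ''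
  lift a to ℝ≥0 using (ha.trans_le le_top).ne with γ₀ hγ₀
  lift b to ℝ≥0 using hb with K₀ hK₀
  have hγ₀1 : γ₀ < 1 := by exact_mod_cast ha
  have hdriftR : ∀ x, ∫⁻ y, (V y : ℝ≥0∞) ∂(R x) ≤ (γ₀ : ℝ≥0∞) * V x + K₀ := fun x => hlyR x
  have hdrift : ∀ x, ∫⁻ y, (V y : ℝ≥0∞) ∂(K x) ≤ (γ₀ : ℝ≥0∞) * V x + K₀ := fun x => by
    rw [hKdef, Sg.lintegral_embeddedFlipKernel_of_invariant (W := fun y => (V y : ℝ≥0∞))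
      (measurable_coe_nnreal_ennreal.comp hVm) hVflip x]
    exact hlyR x
  -- (2) minorisation on a large compact energy sublevel set
  set R₀ : ℝ≥0 := 2 * K₀ / (1 - γ₀) + 1 with hR₀
  have h1γ : 0 < 1 - γ₀ := tsub_pos_of_lt hγ₀1
  have hR₀big : 2 * K₀ < (1 - γ₀) * R₀ := by
    rw [hR₀, mul_add, mul_div_cancel₀ _ h1γ.ne', mul_one]
    exact lt_add_of_pos_right _ h1γ
  set C : Set (PhaseSpace N) := {x | V x ≤ R₀} with hCdef
  have hCc : IsCompact C := pinnedChain_isCompact_setOf_exp_le hω hl.le hβ.le γ N hθ0 R₀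
  obtain ⟨m, hm0, hm⟩ := pinnedChain_embeddedFlipKernel_minorization hω hl.le hβ hγ hN0 hTL hTR hr hCc
  have hminor_ex : ∃ (α : ℝ≥0) (ν : Measure (PhaseSpace N)), IsProbabilityMeasure ν ∧ 0 < α ∧
      ∀ z, V z ≤ R₀ → α • ν ≤ K z := by
    rcases C.eq_empty_or_nonempty with hCe | hCne
    · refine ⟨1, Measure.dirac 0, inferInstance, one_pos, fun z hz => ?_⟩
      have : z ∈ C := hz
      rw [hCe] at this; exact this.elim
    · obtain ⟨α, ν, hν, hα, hmin⟩ := exists_minorization_prob hm0 hm hCne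
      exact ⟨α, ν, hν, hα, fun z hz => hmin z hz⟩
  obtain ⟨α, ν, hν, hα, hminor⟩ := hminor_ex
  haveI := hν
  -- (3) Harris
  obtain ⟨abar, βh, habar0, habar1, hβh, -, -, hiii⟩ := Harris.harris K hVm hγ₀1 hdrift hα hR₀big hminor
  -- (4) the invariant law of `K` and `π R = μ_T`
  obtain ⟨π, hπ, hinv, hfin⟩ := pinnedChain_exists_invariant_embeddedFlipKernel hω hl hβ hγ hN hTL hTR hr hθ0 hθ''
  haveI := hπ
  have hsteady : P.IsFlipSteadyState N T_L T_R ε (π.bind R) :=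
    pinnedChain_isFlipSteadyState_bind_resolventKernel hω hl hβ hγ hN hTL hTR hε hθ0 hθ'' π hinv hfin
  have hπR : π.bind R = μ := hμ.2 _ hsteady
  obtain ⟨hπV, hconv⟩ := hiii π hπ hinv
  have hπVtop : ∫⁻ x, (V x : ℝ≥0∞) ∂π ≠ ⊤ := ne_top_of_le_ne_top ENNReal.coe_ne_top hπV
  set πV : ℝ := (∫⁻ x, (V x : ℝ≥0∞) ∂π).toReal with hπVdef
  have hπV0 : 0 ≤ πV := ENNReal.toReal_nonneg
  -- (5) the source `ψ = (Nε)⁻¹ R k_0`, its affine bound and its centring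
  set i0 : Fin N := ⟨0, hN0⟩ with hi0
  set k0 : PhaseSpace N → ℝ := fun y => y.2 i0 ^ 2 - T with hk0
  have hk0c : Continuous k0 := by rw [hk0]; fun_prop
  -- the centring constant `c = μ(k_0)` (the unique flip steady state integrates `e^{θH}`)
  haveI : IsProbabilityMeasure μ := hμ.1.isProbabilityMeasure
  have hexpμ : Integrable (fun x => Real.exp (θ * H x)) μ :=
    integrable_exp_of_unique hω hl hβ hγ hTL hTR hε hμ hθ0 hθ''
  have hk0μ : Integrable k0 μ :=
    integrable_of_abs_le_exp hexpμ hk0c fun y => abs_sq_momentum_sub_le_exp (γ := γ) hω hl.le hβ.le hθ0 hT.le y i0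
  set c : ℝ := ∫ w, k0 w ∂μ with hc
  set k : PhaseSpace N → ℝ := fun y => k0 y - c with hk
  have hkc : Continuous k := by rw [hk]; fun_prop
  have hkm : Measurable k := hkc.measurable
  set cθ : ℝ := 2 / θ + T + |c| with hcθ
  have hcθ0 : 0 ≤ cθ := by positivity
  have hkb : ∀ y, |k y| ≤ 0 + cθ * (V y : ℝ) := fun y => by
    rw [zero_add, hVreal, hk]
    dsimp only
    have h1 := abs_sq_momentum_sub_le_exp (γ := γ) hω hl.le hβ.le hθ0 hT.le y i0
    have h2 : 1 ≤ Real.exp (θ * H y) := Real.one_le_exp (mul_nonneg hθ0.le (hH0 y))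
    calc |k0 y - c| ≤ |k0 y| + |c| := abs_sub _ _
      _ ≤ (2 / θ + T) * Real.exp (θ * H y) + |c| * Real.exp (θ * H y) :=
          add_le_add h1 (le_mul_of_one_le_right (abs_nonneg _) h2)
      _ = cθ * Real.exp (θ * H y) := by rw [hcθ]; ring
  have hVR : ∀ x, ∫⁻ y, (V y : ℝ≥0∞) ∂(R x) ≠ ⊤ := fun x =>
    ne_top_of_le_ne_top (by simp [ENNReal.mul_eq_top]) (hdriftR x)
  have hkint : ∀ x, Integrable k (R x) := fun x => Harris.integrable_of_abs_le_affine hVm (hVR x) hkm hkb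
  have htoReal : ∀ x, (((γ₀ : ℝ≥0∞) * V x + K₀)).toReal = γ₀ * (V x : ℝ) + K₀ := by
    intro x
    rw [ENNReal.toReal_add (by simp [ENNReal.mul_eq_top]) ENNReal.coe_ne_top, ENNReal.toReal_mul]
    simp
  have hRbound : ∀ x, (∫⁻ y, (V y : ℝ≥0∞) ∂(R x)).toReal ≤ γ₀ * (V x : ℝ) + K₀ := fun x => by
    rw [← htoReal x]; exact ENNReal.toReal_mono (by simp [ENNReal.mul_eq_top]) (hdriftR x)
  set ψ : PhaseSpace N → ℝ := fun z => r⁻¹ * ∫ y, k y ∂(R z) with hψ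
  have hψm : Measurable ψ := ((hkc.stronglyMeasurable.integral_kernel (κ := R)).measurable).const_mul _
  have hψb : ∀ z, |ψ z| ≤ r⁻¹ * cθ * K₀ + r⁻¹ * cθ * γ₀ * V z := by
    intro z
    have h1 := Harris.abs_integral_le_of_abs_le_affine hVm (hVR z) hkm hkb
    rw [zero_mul, zero_add] at h1
    rw [hψ]
    dsimp only
    rw [abs_mul, abs_of_pos (inv_pos.2 hr)]
    have h2 : cθ * (∫⁻ y, (V y : ℝ≥0∞) ∂(R z)).toReal ≤ cθ * (γ₀ * (V z : ℝ) + K₀) :=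
      mul_le_mul_of_nonneg_left (hRbound z) hcθ0
    have h3 := mul_le_mul_of_nonneg_left (h1.trans h2) (inv_pos.2 hr).le
    linarith [h3]
  -- centring: `∫ ψ dπ = (Nε)⁻¹ ∫ (k_0 − c) d(πR) = (Nε)⁻¹ (μ(k_0) − c) = 0`
  have hψπ : ∫ z, ψ z ∂π = 0 := by
    have hkμ : Integrable k μ := hk0μ.sub (integrable_const c)
    have hkπR : Integrable k (π.bind R) := by rw [hπR]; exact hkμ
    have h1 := FixedLengthNoiseContinuity.integral_bind_of_integrable R π hkπR
    have h2 : ∫ y, k y ∂(π.bind R) = 0 := by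
      rw [hπR, hk]
      dsimp only
      rw [integral_sub hk0μ (integrable_const c), integral_const, probReal_univ, one_smul, hc, sub_self]
    rw [hψ]
    dsimp only
    rw [integral_const_mul, ← h1, h2, mul_zero]
  -- normalisation `φ = ψ/M`, `|φ| ≤ 1 + βh V`
  set M : ℝ := r⁻¹ * cθ * K₀ + r⁻¹ * cθ * γ₀ / βh + 1 with hM
  have hM0 : 0 < M := by rw [hM]; positivity
  set φ : PhaseSpace N → ℝ := fun z => ψ z / M with hφ
  have hφm : Measurable φ := hψm.div_const M
  have hφb : ∀ z, |φ z| ≤ 1 + βh * V z := by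
    intro z
    rw [hφ]
    dsimp only
    rw [abs_div, abs_of_pos hM0, div_le_iff₀ hM0]
    have hV0 : 0 ≤ (V z : ℝ) := (V z).coe_nonneg
    have h1 := hψb z
    have e1 : r⁻¹ * cθ * K₀ ≤ M := by
      rw [hM]; have : 0 ≤ r⁻¹ * cθ * γ₀ / βh := by positivity
      linarith
    have e2 : r⁻¹ * cθ * γ₀ * (V z : ℝ) ≤ M * (βh * V z) := by
      have : r⁻¹ * cθ * γ₀ * (V z : ℝ) = (r⁻¹ * cθ * γ₀ / βh) * (βh * V z) := by field_simp
      rw [this]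
      refine mul_le_mul_of_nonneg_right ?_ (by positivity)
      rw [hM]; have : 0 ≤ r⁻¹ * cθ * ↑K₀ := by positivity
      linarith
    nlinarith [e1, e2, h1]
  have hφπ : ∫ z, φ z ∂π = 0 := by
    rw [hφ]; dsimp only
    simp_rw [div_eq_mul_inv]
    rw [integral_mul_const, hψπ, zero_mul]
  -- (6) the Neumann series `G₀ = Σ_n Kⁿ φ`
  set D : PhaseSpace N → ℝ := fun x => 2 + βh * V x + βh * πV with hD
  have hD0 : ∀ x, 0 ≤ D x := fun x => by rw [hD]; positivity
  set w : ℕ → PhaseSpace N → ℝ := fun n x => ∫ z, φ z ∂((K ^ n) x) with hw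
  have hwm : ∀ n, Measurable (w n) := fun n => (hφm.stronglyMeasurable.integral_kernel (κ := K ^ n)).measurable
  have hwb : ∀ n x, |w n x| ≤ abar ^ n * D x := by
    intro n x
    have h := hconv n φ hφm hφb x
    rw [hφπ, sub_zero] at h
    exact h
  have hsumm : ∀ x, Summable fun n => w n x := fun x =>
    Summable.of_norm_bounded (g := fun n => abar ^ n * D x)
      ((summable_geometric_of_lt_one habar0.le habar1).mul_right (D x)) fun n => by
        rw [Real.norm_eq_abs]; exact hwb n x
  set G₀ : PhaseSpace N → ℝ := fun x => ∑' n, w n x with hG₀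
  have hG₀m : Measurable G₀ := by
    refine measurable_of_tendsto_metrizable (f := fun m x => ∑ n ∈ Finset.range m, w n x)
      (fun m => Finset.measurable_sum _ fun n _ => hwm n) ?_
    rw [tendsto_pi_nhds]
    exact fun x => (hsumm x).hasSum.tendsto_sum_nat
  have hG₀b : ∀ x, |G₀ x| ≤ D x / (1 - abar) := by
    intro x
    have h1 : ‖∑' n, w n x‖ ≤ ∑' n, abar ^ n * D x :=
      tsum_of_norm_bounded ((summable_geometric_of_lt_one habar0.le habar1).mul_right (D x)).hasSum
        fun n => by rw [Real.norm_eq_abs]; exact hwb n x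
    rw [tsum_mul_right, tsum_geometric_of_lt_one habar0.le habar1] at h1
    rw [hG₀]; dsimp only
    rw [← Real.norm_eq_abs]
    calc ‖∑' n, w n x‖ ≤ (1 - abar)⁻¹ * D x := h1
      _ = D x / (1 - abar) := by rw [div_eq_inv_mul]
  -- integrability of affinely bounded functions under `K x`, `(Kⁿ) x`, `R x`
  have hVK : ∀ x, ∫⁻ y, (V y : ℝ≥0∞) ∂(K x) ≠ ⊤ := fun x =>
    ne_top_of_le_ne_top (by simp [ENNReal.mul_eq_top]) (hdrift x)
  have hVKn : ∀ n x, ∫⁻ y, (V y : ℝ≥0∞) ∂((K ^ n) x) ≠ ⊤ := fun n x =>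
    Harris.lintegral_pow_ne_top K hVm hγ₀1 hdrift n x
  have h1ab : 0 < 1 - abar := by linarith
  -- (7) the fixed-point equation `G₀ = φ + K G₀`
  have hwsucc : ∀ n x, ∫ y, w n y ∂(K x) = w (n + 1) x := by
    intro n x
    haveI := Harris.isMarkovKernel_pow K n
    haveI := Harris.isMarkovKernel_pow K (n + 1)
    have hint : Integrable φ ((K ^ (n + 1)) x) :=
      Harris.integrable_of_abs_le_affine hVm (hVKn (n + 1) x) hφm (A := 1) (B := βh) hφb
    rw [hw]; dsimp only
    rw [Harris.pow_succ_eq_comp] at hint ⊢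
    exact (Kernel.integral_comp hint).symm
  have hKG₀ : ∀ x, ∫ y, G₀ y ∂(K x) = ∑' n, w (n + 1) x := by
    intro x
    rw [hG₀]; dsimp only
    rw [integral_tsum (fun n => (hwm n).aestronglyMeasurable)]
    · exact tsum_congr fun n => hwsucc n x
    · -- `Σ_n ∫⁻ |w n| dK x ≤ Σ_n abarⁿ ∫⁻ D dK x < ∞`
      have hDint : ∫⁻ y, ENNReal.ofReal (D y) ∂(K x) ≠ ⊤ := by
        have e : ∀ y, ENNReal.ofReal (D y) = ENNReal.ofReal (2 + βh * πV) + ENNReal.ofReal βh * V y := by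
          intro y
          rw [hD]; dsimp only
          rw [show (2 : ℝ) + βh * V y + βh * πV = (2 + βh * πV) + βh * V y by ring,
            ENNReal.ofReal_add (by positivity) (by positivity), ENNReal.ofReal_mul hβh.le]
          congr 1
          rw [hVreal, ← hVcoe]
        simp_rw [e]
        have hmV : Measurable fun a : PhaseSpace N => ((V a : ℝ≥0) : ℝ≥0∞) := measurable_coe_nnreal_ennreal.comp hVm
        rw [lintegral_add_left measurable_const, lintegral_const_mul _ hmV,
          lintegral_const, measure_univ, mul_one]
        exact ENNReal.add_ne_top.2 ⟨ENNReal.ofReal_ne_top, ENNReal.mul_ne_top ENNReal.ofReal_ne_top (hVK x)⟩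
      have hDm : Measurable fun y => ENNReal.ofReal (D y) := by
        refine ENNReal.measurable_ofReal.comp ?_
        rw [hD]; fun_prop
      have hle : ∀ n, ∫⁻ y, ‖w n y‖ₑ ∂(K x) ≤ ENNReal.ofReal abar ^ n * ∫⁻ y, ENNReal.ofReal (D y) ∂(K x) := by
        intro n
        rw [← lintegral_const_mul _ hDm]
        refine lintegral_mono fun y => ?_
        rw [Real.enorm_eq_ofReal_abs, ← ENNReal.ofReal_pow habar0.le, ← ENNReal.ofReal_mul (pow_nonneg habar0.le _)]
        exact ENNReal.ofReal_le_ofReal (hwb n y)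
      refine ne_top_of_le_ne_top ?_ (ENNReal.tsum_le_tsum hle)
      rw [ENNReal.tsum_mul_right, ENNReal.tsum_geometric]
      refine ENNReal.mul_ne_top ?_ hDint
      refine ENNReal.inv_ne_top.2 ?_
      exact (tsub_pos_of_lt (ENNReal.ofReal_lt_one.2 habar1)).ne'
  have hfix : ∀ x, G₀ x = φ x + ∫ y, G₀ y ∂(K x) := by
    intro x
    rw [hKG₀ x, hG₀]; dsimp only
    rw [(hsumm x).tsum_eq_zero_add]
    congr 1
    rw [hw]; dsimp only
    rw [Harris.pow_zero_apply, integral_dirac]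
  -- (8) `g = M • G₀` solves `g = ψ + K g = R((Nε)⁻¹ k + Q g)`
  set g : PhaseSpace N → ℝ := fun x => M * G₀ x with hg
  have hgm : Measurable g := hG₀m.const_mul M
  have hgb : ∀ x, |g x| ≤ M / (1 - abar) * (2 + βh * πV) + M / (1 - abar) * βh * V x := by
    intro x
    rw [hg]; dsimp only
    rw [abs_mul, abs_of_pos hM0]
    have h1 := mul_le_mul_of_nonneg_left (hG₀b x) hM0.le
    have e : M * (D x / (1 - abar)) = M / (1 - abar) * (2 + βh * πV) + M / (1 - abar) * βh * V x := by
      rw [hD]; dsimp only; field_simp; ring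
    linarith [h1, e.le]
  have hgintK : ∀ x, Integrable g (K x) := fun x =>
    Harris.integrable_of_abs_le_affine hVm (hVK x) hgm (hgb ·)
  have hQg : ∀ y, ∫ w', g w' ∂(flipKernel N y) = (N : ℝ)⁻¹ * ∑ i : Fin N, g (momentumFlip i y) :=
    fun y => integral_flipKernel hN0 g y
  have hKg : ∀ x, ∫ y, g y ∂(K x) = ∫ y, (N : ℝ)⁻¹ * ∑ i : Fin N, g (momentumFlip i y) ∂(R x) := by
    intro x
    have hint : Integrable g ((flipKernel N ∘ₖ R) x) := by rw [← hKeq]; exact hgintK x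
    rw [show K x = (flipKernel N ∘ₖ R) x by rw [hKeq], Kernel.integral_comp hint]
    exact integral_congr_ae (ae_of_all _ fun y => hQg y)
  have hQgm : Measurable fun y => (N : ℝ)⁻¹ * ∑ i : Fin N, g (momentumFlip i y) :=
    (Finset.measurable_sum _ fun i _ => hgm.comp (measurable_momentumFlip i)).const_mul _
  have hQgb : ∀ y, |(N : ℝ)⁻¹ * ∑ i : Fin N, g (momentumFlip i y)| ≤
      M / (1 - abar) * (2 + βh * πV) + M / (1 - abar) * βh * V y := by
    intro y
    have hVfi : ∀ i : Fin N, (V (momentumFlip i y) : ℝ) = V y := fun i => by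
      simp only [V, hH, OscillatorChain.hamiltonian_momentumFlip]
    rw [abs_mul, abs_of_pos (by positivity : (0 : ℝ) < (N : ℝ)⁻¹)]
    calc (N : ℝ)⁻¹ * |∑ i : Fin N, g (momentumFlip i y)| ≤ (N : ℝ)⁻¹ * ∑ i : Fin N, |g (momentumFlip i y)| :=
          mul_le_mul_of_nonneg_left (Finset.abs_sum_le_sum_abs _ _) (by positivity)
      _ ≤ (N : ℝ)⁻¹ * ∑ _i : Fin N, (M / (1 - abar) * (2 + βh * πV) + M / (1 - abar) * βh * V y) := by
          refine mul_le_mul_of_nonneg_left (Finset.sum_le_sum fun i _ => ?_) (by positivity)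
          have := hgb (momentumFlip i y); rwa [hVfi i] at this
      _ = M / (1 - abar) * (2 + βh * πV) + M / (1 - abar) * βh * V y := by
          rw [Finset.sum_const, Finset.card_univ, Fintype.card_fin, nsmul_eq_mul]
          field_simp
  have hQgint : ∀ x, Integrable (fun y => (N : ℝ)⁻¹ * ∑ i : Fin N, g (momentumFlip i y)) (R x) := fun x =>
    Harris.integrable_of_abs_le_affine hVm (hVR x) hQgm hQgb
  refine ⟨g, hgm, ⟨M / (1 - abar) * (2 + βh * πV) + M / (1 - abar) * βh, fun z => ?_⟩, fun z => ?_⟩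
  · -- the exponential bound
    have h1 := hgb z
    have hV1 := hVge1 z
    have hc0 : 0 ≤ M / (1 - abar) * (2 + βh * πV) := by positivity
    rw [← hVreal z]
    have h2 : M / (1 - abar) * (2 + βh * πV) ≤ M / (1 - abar) * (2 + βh * πV) * (V z : ℝ) :=
      le_mul_of_one_le_right hc0 hV1
    calc |g z| ≤ M / (1 - abar) * (2 + βh * πV) + M / (1 - abar) * βh * V z := h1
      _ ≤ M / (1 - abar) * (2 + βh * πV) * (V z : ℝ) + M / (1 - abar) * βh * V z := by linarith
      _ = (M / (1 - abar) * (2 + βh * πV) + M / (1 - abar) * βh) * (V z : ℝ) := by ring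
  · -- the mild equation
    have h1 : g z = ψ z + ∫ y, g y ∂(K z) := by
      rw [hg]; dsimp only
      rw [hfix z, mul_add, ← integral_const_mul]
      congr 1
      rw [hφ]; dsimp only
      field_simp
    rw [h1, hKg z, hψ]; dsimp only
    rw [← integral_const_mul, ← integral_add ((hkint z).const_mul _) (hQgint z)]


end Mild

/-! ## Registered helper -/

/-- Registered helper sub-goal `helper_flipMildForwardFieldTemps` of stub `stub_flipForwardFieldRegularity` (line
`fekete-usc-one-length`, crux stmt-AtomisticToContinuum-11976): the centred mild forward field of the flip-noisy generator
at unequal bath temperatures (`flip_mildForwardField_exists_temps`). -/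
theorem helper_flipMildForwardFieldTemps : ∀ (ω₂ lam β γ : ℝ) (hω : 0 < ω₂) (hl : 0 < lam) (hβ : 0 < β) (hγ : 0 < γ) (N : ℕ) (hN : 1 < N) (T T_L T_R : ℝ) (hT : 0 < T) (hTL : 0 < T_L) (hTR : 0 < T_R), 1 / (4 * T) < 1 / max T_L T_R → ∀ (ε : ℝ), 0 < ε → ∀ (μ : MeasureTheory.Measure (Literature.MathematicalPhysics.KineticTheory.HeatConduction.PhaseSpace N)), ((Literature.MathematicalPhysics.KineticTheory.HeatConduction.pinnedChain ω₂ lam β γ).IsFlipSteadyState N T_L T_R ε μ ∧ ∀ ν : MeasureTheory.Measure (Literature.MathematicalPhysics.KineticTheory.HeatConduction.PhaseSpace N), (Literature.MathematicalPhysics.KineticTheory.HeatConduction.pinnedChain ω₂ lam β γ).IsFlipSteadyState N T_L T_R ε ν → ν = μ) → ∃ g : Literature.MathematicalPhysics.KineticTheory.HeatConduction.PhaseSpace N → ℝ, Measurable g ∧ (∃ C : ℝ, ∀ z, |g z| ≤ C * Real.exp (1 / (4 * T) * (Literature.MathematicalPhysics.KineticTheory.HeatConduction.pinnedChain ω₂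 lam β γ).hamiltonian N z)) ∧ ∀ z, g z = MeasureTheory.integral ((Literature.MathematicalPhysics.KineticTheory.HeatConduction.pinnedChainSemigroup hω (le_of_lt hl) (le_of_lt hβ) (le_of_lt hγ) (Nat.zero_lt_of_lt hN) (le_of_lt hTL) (le_of_lt hTR)).resolventKernel ((N : ℝ) * ε) z) (fun y => ((N : ℝ) * ε)⁻¹ * ((y.2 ⟨0, Nat.zero_lt_of_lt hN⟩ ^ 2 - T) - MeasureTheory.integral μ (fun w => w.2 ⟨0, Nat.zero_lt_of_lt hN⟩ ^ 2 - T)) + (N : ℝ)⁻¹ * ∑ i : Fin N, g (Literature.MathematicalPhysics.KineticTheory.HeatConduction.momentumFlip i y)) :=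
  fun _ _ _ _ hω hl hβ hγ _ hN _ _ _ hT hTL hTR h4 _ hε _ hμ =>
    flip_mildForwardField_exists_temps hω hl hβ hγ hN hT hTL hTR h4 hε hμ

end Summit.AtomisticToContinuum.FouriersLaw.Theorems.VanishingNoiseBound

end
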